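import Literature.AnabelianGeometry.EtaleTheta.GalSectSplittingsTransport
import HarnessLib

/-!
# [EtTh] Cor. 2.8 (ii) — END-KNIT: the typed `Cor28iiAt` reduced to ONE named input, an `Aut`-equivariant
# family of `μ_n`-structures (the image cusp and the class transport being THEOREMS) (proof-only)

Mochizuki, *The étale theta function …* [EtTh], Publ. RIMS **45** (2009), Cor. 2.8 (ii) p.268, Cor. 2.9 p.269
[cite: MochizukiEtTh2009, Cor 2.8 (ii) p.42]; [GalSect] §4 [cite: MochizukiGalSect2005, §4 p.33].  abc-iut cell,
layer L2, row «Thm 1.10 (iii) / Cor 2.8 (ii) END-KNIT at the genuine H¹-torsor» (abc-iut-L2-lead gen 3, R210;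
seat abc-iut-w5-d062 gen 3), the Cor. 2.8 (ii) half.  PROOF-ONLY: no definitions, no named facts.

ROW (B)'s `Cor28iiAt S L n 𝒟` (`GalSectCuspPairTorsors.lean`) is `∃ R, (∀ g, R g a μ_n-sub-structure of the
canonical structure) ∧ ∀ Γ stabilising L, ∀ g, ∃ g', Γ carries R g onto R g'`.  Unlike Thm. 1.10 (iii) (O1 /
`GalSectThm110iiiEndKnit`), existence of orbits does NOT settle it: the family `R` is chosen BEFORE `Γ` ranges
over all automorphisms, so it must be EQUIVARIANT.  Here the bookkeeping is discharged completely: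

* `cuspPairAt_map_eq_of_conj` — for `Γ` stabilising the member `S` and `Δ^tp_C` and carrying the cusp
  decomposition group `D_C` to a conjugate `h·D_C·h⁻¹`, the image of the cuspidal pair at `g` IS the cuspidal
  pair at the cusp `Γ(g)·h` (generalises ROW (B)'s `cuspPairAt_map_eq`, which had `h = 1`);
* **`cor28iiAt_of_equivariantFamily`** — `Cor28iiAt` follows from: the stabilisation data for the automorphisms
  of the list `L` (member `S` stabilised — `S ∈ L`; `Δ^tp_C` stabilised — [AbsAnab] Lem. 1.3.8 genre; `D_C`
  carried to a conjugate — cuspidal decomposition groups are group-theoretic, [SemiAnbd] Thm. 6.8 (iii) /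
  [AbsTopI] Lem. 4.5 genre) and ONE substantive named input: a family `R g` of `μ_n`-sub-structures of the
  canonical integral structures which is EQUIVARIANT — the class transport along each such `Γ` (a THEOREM:
  `exists_classTransport`, p433009) carries `R g` onto `R (Γ g · h)`.  In print this family is the one
  "determined by `η̈^{Θ,Z}`" (Thm. 1.10 (iii)), and its equivariance is Thm. 1.10 (iii)'s "preserved by `γ`".
* `Cor28iiAt.image_classTransport_eq` — conversely (given that the automorphisms of `L` stabilise `Δ^tp_C`)
  any witness family of `Cor28iiAt` IS equivariant: each `Γ` carries `R g` onto the member of the family at the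
  image cusp (`PreservedBy.eq_image_classTransport`) — so the named input is exactly the typed content.

HONEST FRAMING: nothing printed is asserted; the equivariant family is an INPUT (never constructed here); typed ≠
proved; no side taken on [IUTchIII] Cor. 3.12, on which nothing here bears.
-/

noncomputable section

namespace Literature.AnabelianGeometry.EtaleTheta

open scoped Pointwise

namespace ThetaCovers

namespace TemperedCoverData

universe u

variable {l : ℕ} (T : TemperedCoverData.{u} l)

/-- **The image cusp, up to the conjugation ambiguity of `D_C`.**  For an automorphism `Γ` of `Π^tp_C`
stabilising the member `S = Π^tp_Z` and `Δ^tp_C`, and carrying the cusp decomposition group `D_C` to the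
conjugate `h·D_C·h⁻¹`, the image of the cuspidal pair at the cusp `g` is the cuspidal pair at the cusp
`Γ(g)·h` — PROVED. [cite: MochizukiEtTh2009, Cor 2.8 (ii) p.42] -/
theorem cuspPairAt_map_eq_of_conj (S : Subgroup T.Gtp) (Γ : T.Gtp ≃ₜ* T.Gtp)
    (hS : S.map Γ.toMulEquiv.toMonoidHom = S) {h : T.Gtp}
    (hC : T.cuspStabC.map Γ.toMulEquiv.toMonoidHom = MulAut.conj h • T.cuspStabC)
    (hΔ : T.DeltaTp.map Γ.toMulEquiv.toMonoidHom = T.DeltaTp) (g : T.Gtp) :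
    (T.cuspPairAt S g).map Γ = T.cuspPairAt S (Γ g * h) := by
  have hinj : Function.Injective Γ.toMulEquiv.toMonoidHom := Γ.toMulEquiv.injective
  have hD : (S ⊓ MulAut.conj g • T.cuspStabC).map Γ.toMulEquiv.toMonoidHom =
      S ⊓ MulAut.conj (Γ g * h) • T.cuspStabC := by
    rw [Subgroup.map_inf _ _ _ hinj, hS, GalSect.map_conj_smul, hC, ← mul_smul, ← map_mul]
    rfl
  refine GalSect.CuspPair.ext' ?_ ?_
  · exact hD
  · change ((S ⊓ MulAut.conj g • T.cuspStabC) ⊓ T.DeltaTp).map Γ.toMulEquiv.toMonoidHom =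
      (S ⊓ MulAut.conj (Γ g * h) • T.cuspStabC) ⊓ T.DeltaTp
    rw [Subgroup.map_inf _ _ _ hinj, hD, hΔ]

/-- **[EtTh] Cor. 2.8 (ii) END-KNIT.**  `Cor28iiAt S L n 𝒟` follows from the stabilisation data of the
automorphisms of the list `L` and ONE substantive named input: an EQUIVARIANT family `R` of
`μ_n`-sub-structures of the canonical integral structures (the class transport carries `R g` onto the member
of the family at the image cusp).  The image cusp (`cuspPairAt_map_eq_of_conj`) and the class transport
(`exists_classTransport`, `preservedBy_image_classTransport`) are THEOREMS.
[cite: MochizukiEtTh2009, Cor 2.8 (ii) p.42] -/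
theorem cor28iiAt_of_equivariantFamily (S : Subgroup T.Gtp) (L : List (Subgroup T.Gtp)) (n : ℕ)
    {A : Type u} [Group A] (𝒟 : T.Cor28iiData S A)
    -- stabilisation data of the automorphisms of `L`
    (hstab : ∀ Γ : T.Gtp ≃ₜ* T.Gtp, (∀ S' ∈ L, S'.map Γ.toMulEquiv.toMonoidHom = S') →
      S.map Γ.toMulEquiv.toMonoidHom = S ∧ T.DeltaTp.map Γ.toMulEquiv.toMonoidHom = T.DeltaTp ∧
        ∃ h : T.Gtp, T.cuspStabC.map Γ.toMulEquiv.toMonoidHom = MulAut.conj h • T.cuspStabC)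
    -- THE named input: an equivariant family of `μ_n`-sub-structures of the canonical structures
    (R : ∀ g : T.Gtp, Set (T.cuspPairAt S g).SplittingClass)
    (hR : ∀ g, (𝒟.torsor g).IsSubStructure (𝒟.mu n) (𝒟.canonical g) (R g))
    (hReq : ∀ (Γ : T.Gtp ≃ₜ* T.Gtp) (g g' : T.Gtp)
        (e : (T.cuspPairAt S g).SplittingClass → (T.cuspPairAt S g').SplittingClass),
      (∀ S' ∈ L, S'.map Γ.toMulEquiv.toMonoidHom = S') →
      (T.cuspPairAt S g).map Γ = T.cuspPairAt S g' →
      (∀ (S₁ : Subgroup T.Gtp) (hS₁ : S₁ ∈ (T.cuspPairAt S g).splittings),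
        ∃ h', e (GalSect.CuspPair.SplittingClass.mk _ S₁ hS₁) =
          GalSect.CuspPair.SplittingClass.mk _ (S₁.map Γ.toMulEquiv.toMonoidHom) h') →
      e '' R g = R g') :
    T.Cor28iiAt S L n 𝒟 := by
  intro _ _ _
  refine ⟨R, hR, fun Γ hΓ g => ?_⟩
  obtain ⟨hS, hΔ, h, hC⟩ := hstab Γ hΓ
  have hpair := T.cuspPairAt_map_eq_of_conj S Γ hS hC hΔ g
  obtain ⟨e, he⟩ := GalSect.CuspPair.exists_classTransport Γ hpair
  refine ⟨Γ g * h, ?_⟩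
  have key := GalSect.CuspPair.preservedBy_image_classTransport hpair he (R g)
  rwa [hReq Γ g (Γ g * h) e hΓ hpair he] at key

/-- Conversely, the bookkeeping in the other direction: a witness family of `Cor28iiAt` is carried by each
`L`-stabilising `Γ` onto the member of the family at the image cusp — i.e. any witness IS an equivariant
family (for the image-cusp map `g ↦ g'` it provides). [cite: MochizukiEtTh2009, Cor 2.8 (ii) p.42] -/
theorem Cor28iiAt.image_classTransport_eq {S : Subgroup T.Gtp} {L : List (Subgroup T.Gtp)} {n : ℕ}
    {A : Type u} [Group A] {𝒟 : T.Cor28iiData S A} (h28 : T.Cor28iiAt S L n 𝒟) (hμ : T.HasMuL)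
    (hres : 𝒟.ResCharPrimeToL) (hrat : ∀ g, T.IsRationalCusp S g)
    (hΔ : ∀ Γ : T.Gtp ≃ₜ* T.Gtp, (∀ S' ∈ L, S'.map Γ.toMulEquiv.toMonoidHom = S') →
      T.DeltaTp.map Γ.toMulEquiv.toMonoidHom = T.DeltaTp) :
    ∃ R : ∀ g : T.Gtp, Set (T.cuspPairAt S g).SplittingClass,
      (∀ g, (𝒟.torsor g).IsSubStructure (𝒟.mu n) (𝒟.canonical g) (R g)) ∧
      ∀ Γ : T.Gtp ≃ₜ* T.Gtp, (∀ S' ∈ L, S'.map Γ.toMulEquiv.toMonoidHom = S') →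
        ∀ g, ∃ g', (T.cuspPairAt S g).map Γ = T.cuspPairAt S g' ∧
          ∀ (e : (T.cuspPairAt S g).SplittingClass → (T.cuspPairAt S g').SplittingClass),
            (∀ (S₁ : Subgroup T.Gtp) (hS₁ : S₁ ∈ (T.cuspPairAt S g).splittings),
              ∃ h', e (GalSect.CuspPair.SplittingClass.mk _ S₁ hS₁) =
                GalSect.CuspPair.SplittingClass.mk _ (S₁.map Γ.toMulEquiv.toMonoidHom) h') →
            R g' = e '' R g := by
  obtain ⟨R, hR, hΓ⟩ := h28 hμ hres hrat
  refine ⟨R, hR, fun Γ hL g => ?_⟩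
  obtain ⟨g', hpres⟩ := hΓ Γ hL g
  have hinj : Function.Injective Γ.toMulEquiv.toMonoidHom := Γ.toMulEquiv.injective
  have hD : (T.cuspPairAt S g).D.map Γ.toMulEquiv.toMonoidHom = (T.cuspPairAt S g').D := hpres.1
  have hpair : (T.cuspPairAt S g).map Γ = T.cuspPairAt S g' := GalSect.CuspPair.ext' hD (by
    change ((T.cuspPairAt S g).D ⊓ T.DeltaTp).map Γ.toMulEquiv.toMonoidHom = (T.cuspPairAt S g').D ⊓ T.DeltaTp
    rw [Subgroup.map_inf _ _ _ hinj, hD, hΔ Γ hL])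
  exact ⟨g', hpair, fun e he => hpres.eq_image_classTransport hpair he⟩

end TemperedCoverData

end ThetaCovers

end Literature.AnabelianGeometry.EtaleTheta

end
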